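import Summits.CriticalPhenomena.PercolationContinuityZ3.Theorems.PercGamblersRuinVerticalGamblersRuinStubPathReversal

/-!
# Route `PercGamblersRuin`, crux `VerticalGamblersRuin` (stmt-CriticalPhenomena-10642):
# stub `stub_exitTimeBound` — the annealed Lyons–Zheng exit-time bound

Helper file for the stub `stub_exitTimeBound` of the line `registered` (skeleton rev 8) of the
crux `PercGamblersRuin.VerticalGamblersRuin`.  Setting: bond configurations `ω` on `ℤ³` under
`P = P_{p_c}`; `N_ω(x)` = lattice neighbours `y ∼ x` with `s(x, y)` open, `deg_ω(0) = #N_ω(0) ≤ 6`;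
height `h z = z₀`; drift `D ω z = (∑_{y ∈ N_ω(z)} (h y - h z)) / #N_ω(z)`; path functional
`E ω T x G = E^ω_x[G [X_0, …, X_T]]` of the SRW on the open lattice edges (pinned by its first-step
recursion `hE0`/`hEs`); `𝒦_ω` = one-step averaging killed outside the open slab `(-m, m)`.

Statement proved (exact registered signature, CONDITIONAL on the statements of the landed stubs
`stub_forwardKolmogorov` — quenched Kolmogorov inequality `λ²·E ω T x (X_λ ω) ≤ 4T` for the
exceedance indicator `X_λ(ω, l) = 1_{∃ t ≤ T, λ ≤ |M_t(ω,l)|}` of the forward martingale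
`M_t(ω, l) = h x_t - h x_0 - ∑_{s<t} D ω x_s` — and `stub_pathReversal` — reversibility of the
degree-biased annealed path law under `(ω, l) ↦ (ω - x_T, rev l - x_T)`): for `m ≥ 1` and all `T`,
`∫_{0↔∞} deg_ω(0) · (1 - (𝒦_ω^T 1)(0)) dP ≤ 480 · T / m²`.

Proof (Lyons–Zheng).  PATHWISE: for a lattice path `l = [x_0, …, x_T]`, `l' = rev l - v` read
in `ω' = ω - v` and `t + k = T`:
`M_t(ω,l) + M_k(ω',l') - M_T(ω',l') = 2(h x_t - h x_0) + D ω x_t - D ω x_0` (translation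
covariance of the drift + telescoping), and `|D| ≤ 1`; so with `λ = (2m-2)/3`, if both exceedance
indicators vanish then `|h x_t| < m` for all `t ≤ T` (`one_le_exceed_add`).  LINK
`(𝒦^T 1)(0) = E ω T 0 (∏_{t<T} 1_{|h x_t| < m})` (`stub_pathFunctionalBasics`), mass one, linearity,
support and monotonicity of `E` give pointwise
`deg·(1 - 𝒦^T 1(0)) ≤ deg·E ω T 0 (X_λ ω) + deg·E ω T 0 (l ↦ X_λ (ω - x_T) (rev l - x_T))`; the
second integral equals the first (reversal), which is `≤ 24 T/λ²` (Kolmogorov, `deg ≤ 6`); total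
`48 T/λ² ≤ 432 T/m²`.  (`T = 0`: the integrand vanishes; `m = 1`: `∫ deg ≤ 6`.)

## References

* R. Lyons, Y. Peres, *Probability on Trees and Networks*, Cambridge University Press (2016),
  §2.1 and §13.1 (forward/backward martingale decomposition of Lyons–Zheng).
* T. Lyons, W. Zheng, *A crossing estimate for the canonical process on a Dirichlet space and a
  tightness result*, Astérisque 157–158 (1988), 249–271.
-/

noncomputable section

namespace Summit.CriticalPhenomena.PercolationContinuityZ3.Theorems.VerticalGamblersRuin

open MeasureTheory Filter Topology
open Literature.Probability.Percolation Literature.Probability.LatticeModels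
open scoped Classical

namespace StubExitTimeBound

/-- **Telescoping**: the forward martingale `a t - a 0 - ∑_{s<t} b s` of heights `a` and drifts
`b`, plus the backward one at time `k`, minus the backward one at time `t + k`. -/
theorem telescope (a b : ℕ → ℝ) (t k : ℕ) :
    (a t - a 0 - ∑ s ∈ Finset.range t, b s) +
        (a (t + k - k) - a (t + k) - ∑ s ∈ Finset.range k, b (t + k - s)) -
      (a (t + k - (t + k)) - a (t + k) - ∑ s ∈ Finset.range (t + k), b (t + k - s)) =
    2 * (a t - a 0) + b t - b 0 := by
  have hrefl : ∑ j ∈ Finset.range t, b (t - 1 - j + 1) = ∑ j ∈ Finset.range t, b (j + 1) :=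
    Finset.sum_range_reflect (fun j => b (j + 1)) t
  have h1 : ∑ s ∈ Finset.range (t + k), b (t + k - s) =
      ∑ s ∈ Finset.range k, b (t + k - s) + ∑ j ∈ Finset.range t, b (j + 1) := by
    rw [← hrefl, add_comm t k, Finset.sum_range_add]
    refine congrArg₂ (· + ·) rfl (Finset.sum_congr rfl fun j hj => ?_)
    rw [show k + t - (k + j) = t - 1 - j + 1 by rw [Finset.mem_range] at hj; omega]
  have h2 : ∑ j ∈ Finset.range t, b (j + 1) + b 0 = ∑ s ∈ Finset.range t, b s + b t := by
    rw [← Finset.sum_range_succ' b t, Finset.sum_range_succ]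
  rw [h1, Nat.add_sub_cancel, Nat.sub_self]
  linarith

/-- Entries of the reversed path translated by `-v`: for `l` of length `n + 1` and `u ≤ n`,
`(rev l - v)_u = l_{n-u} - v`. -/
theorem getD_reverse_map_sub {l : List (Site 3)} {n : ℕ} (hl : l.length = n + 1) (v : Site 3)
    {u : ℕ} (hu : u ≤ n) :
    ((l.reverse).map (fun z => z - v)).getD u 0 = l.getD (n - u) 0 - v := by
  simp only [List.getD_eq_getElem?_getD]
  rw [List.getElem?_map, List.getElem?_reverse (by rw [hl]; omega), hl, Nat.add_sub_cancel,
    List.getElem?_eq_getElem (by rw [hl]; omega)]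
  simp only [Option.map_some, Option.getD_some]

variable {D : BondConfig (Site 3) → Site 3 → ℝ}
  (hD : ∀ ω (z : Site 3), D ω z =
    (∑ y ∈ ((zdGraph 3).neighborFinset z).filter (fun y => s(z, y) ∈ ω),
        ((((y 0 : ℤ) : ℝ)) - ((z 0 : ℤ) : ℝ))) /
      ((((zdGraph 3).neighborFinset z).filter (fun y => s(z, y) ∈ ω)).card : ℝ))
include hD

/-- **Translation covariance of the drift**: `D (ω - v) (z - v) = D ω z` (the open neighbours
of `z - v` in `ω - v` are those of `z` in `ω` translated by `-v`). -/
theorem drift_shift (ω : BondConfig (Site 3)) (v z : Site 3) :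
    D (BondConfig.relabel (sym2Equiv (Site.shift (-v))) ω) (z - v) = D ω z := by
  simp only [hD, StubPathReversal.filter_sub_eq_map, Finset.card_map, Finset.sum_map,
    Equiv.coe_toEmbedding, Equiv.subRight_apply, Pi.sub_apply, Int.cast_sub,
    sub_sub_sub_cancel_right]

/-- **The drift is bounded by one**: it is an average of height increments along lattice
edges, each in `[-1, 1]` (and `0` at a site without open neighbour). -/
theorem abs_drift_le_one (ω : BondConfig (Site 3)) (z : Site 3) : |D ω z| ≤ 1 := by
  rcases (((zdGraph 3).neighborFinset z).filter (fun y => s(z, y) ∈ ω)).eq_empty_or_nonempty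
    with h | h
  · rw [hD, h, Finset.sum_empty, zero_div, abs_zero]; exact zero_le_one
  · refine StubForwardKolmogorov.abs_d_le_one
      (N := fun z => ((zdGraph 3).neighborFinset z).filter (fun y => s(z, y) ∈ ω))
      (hgt := fun z : Site 3 => ((z 0 : ℤ) : ℝ)) (d := D ω) (hD ω) (fun x y hy => ?_) z h
    have hadj : (zdGraph 3).Adj x y :=
      (SimpleGraph.mem_neighborFinset _ _ _).mp (Finset.mem_filter.mp hy).1
    have h1 : ((y 0 : ℤ) : ℝ) ≤ ((x 0 : ℤ) : ℝ) + 1 := by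
      exact_mod_cast SlabVoltage.apply_zero_le_of_adj hadj
    have h2 : ((x 0 : ℤ) : ℝ) ≤ ((y 0 : ℤ) : ℝ) + 1 := by
      exact_mod_cast SlabVoltage.apply_zero_le_of_adj hadj.symm
    exact abs_le.2 ⟨by linarith, by linarith⟩

/-- **Measurability of the drift** in the configuration (finite sum of one-edge indicators). -/
theorem measurable_drift (z : Site 3) : Measurable fun ω => D ω z := by
  simp only [hD, Finset.sum_filter]
  exact Measurable.div (Finset.measurable_sum _ fun y _ => Measurable.ite
    (measurableSet_mem (s(z, y) : Sym2 (Site 3))) measurable_const measurable_const)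
    (DeterministicTime.measurable_deg z)

/-- **The backward martingale through the original path.**  For `l` of length `n + 1`,
`l' = rev l - v`, `ω' = ω - v` and `u ≤ n`:
`h l'_u - h l'_0 - ∑_{s<u} D ω' l'_s = h l_{n-u} - h l_n - ∑_{s<u} D ω l_{n-s}`. -/
theorem rev_functional (ω : BondConfig (Site 3)) (v : Site 3) {l : List (Site 3)} {n : ℕ}
    (hl : l.length = n + 1) {u : ℕ} (hu : u ≤ n) :
    (((((l.reverse).map (fun z => z - v)).getD u 0) 0 : ℤ) : ℝ) -
          (((((l.reverse).map (fun z => z - v)).getD 0 0) 0 : ℤ) : ℝ) -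
        ∑ s ∈ Finset.range u, D (BondConfig.relabel (sym2Equiv (Site.shift (-v))) ω)
          (((l.reverse).map (fun z => z - v)).getD s 0) =
      (((l.getD (n - u) 0) 0 : ℤ) : ℝ) - (((l.getD n 0) 0 : ℤ) : ℝ) -
        ∑ s ∈ Finset.range u, D ω (l.getD (n - s) 0) := by
  have hsum : ∑ s ∈ Finset.range u, D (BondConfig.relabel (sym2Equiv (Site.shift (-v))) ω)
      (((l.reverse).map (fun z => z - v)).getD s 0) =
      ∑ s ∈ Finset.range u, D ω (l.getD (n - s) 0) :=
    Finset.sum_congr rfl fun s hs => by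
      rw [getD_reverse_map_sub hl v ((Finset.mem_range.1 hs).le.trans hu), drift_shift hD]
  rw [getD_reverse_map_sub hl v hu, getD_reverse_map_sub hl v (Nat.zero_le n), Nat.sub_zero, hsum]
  simp only [Pi.sub_apply, Int.cast_sub]
  ring

/-- **Measurability of the exceedance indicator** `X_λ(ω, l)` in `ω` for a fixed path `l`
(a finite union over `t` of the measurable events `λ ≤ |c_t - ∑_{s<t} D ω l_s|`). -/
theorem measurable_exceed {lam : ℝ} {X : BondConfig (Site 3) → List (Site 3) → ℝ}
    (hX : ∀ ω l, X ω l = if ∃ t < l.length,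
        lam ≤ |(((l.getD t 0) 0 : ℤ) : ℝ) - (((l.getD 0 0) 0 : ℤ) : ℝ) -
          ∑ s ∈ Finset.range t, D ω (l.getD s 0)| then (1 : ℝ) else 0)
    (l : List (Site 3)) : Measurable fun ω => X ω l := by
  simp only [hX]
  refine Measurable.ite (measurableSet_setOf.2 (Measurable.exists fun t => measurable_const.and
    (measurableSet_setOf.1 (measurableSet_le measurable_const ?_)))) measurable_const
    measurable_const
  exact (measurable_const.sub (Finset.measurable_sum _ fun s _ => measurable_drift hD _)).abs

/-- **The pathwise Lyons–Zheng bound.**  Let `3λ + 2 ≤ 2m`, `l` a path of length `T + 1` from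
the origin, `l' = rev l - v`, `ω' = ω - v`.  If `l` leaves the slab `(-m, m)` before time `T`, one
of the exceedance indicators `X_λ(ω, l)`, `X_λ(ω', l')` is `1`: otherwise all `|M_t(ω,l)|`,
`|M_u(ω',l')|` are `< λ` and `telescope`, `rev_functional`, `|D| ≤ 1` give `2|h x_t| < 3λ + 2`. -/
theorem one_le_exceed_add {lam : ℝ} {m T : ℕ} (hlm : 3 * lam + 2 ≤ 2 * (m : ℝ))
    {X : BondConfig (Site 3) → List (Site 3) → ℝ}
    (hX : ∀ ω l, X ω l = if ∃ t < l.length,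
        lam ≤ |(((l.getD t 0) 0 : ℤ) : ℝ) - (((l.getD 0 0) 0 : ℤ) : ℝ) -
          ∑ s ∈ Finset.range t, D ω (l.getD s 0)| then (1 : ℝ) else 0)
    (ω : BondConfig (Site 3)) (v : Site 3) {l : List (Site 3)} (hl : l.length = T + 1)
    (h0 : l.getD 0 0 = 0) (hin : ¬ ∀ t < T, -(m : ℤ) < (l.getD t 0) 0 ∧ (l.getD t 0) 0 < (m : ℤ)) :
    1 ≤ X ω l + X (BondConfig.relabel (sym2Equiv (Site.shift (-v))) ω)
      ((l.reverse).map (fun z => z - v)) := by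
  rw [hX, hX]
  split_ifs <;> norm_num
  rename_i h1 h2
  push Not at h1 h2
  refine hin fun t ht => ?_
  obtain ⟨k, rfl⟩ := Nat.exists_eq_add_of_le ht.le
  have hlen : ((l.reverse).map (fun z => z - v)).length = t + k + 1 := by
    rw [List.length_map, List.length_reverse, hl]
  have hp := h1 t (by rw [hl]; omega)
  have hq := h2 k (by rw [hlen]; omega)
  have hr := h2 (t + k) (by rw [hlen]; omega)
  rw [rev_functional hD ω v hl (Nat.le_add_left k t), abs_lt] at hq
  rw [rev_functional hD ω v hl le_rfl, abs_lt] at hr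
  have key := telescope (fun s => (((l.getD s 0) 0 : ℤ) : ℝ)) (fun s => D ω (l.getD s 0)) t k
  beta_reduce at key
  have ha0 : (((l.getD 0 0) 0 : ℤ) : ℝ) = 0 := by rw [h0]; simp
  obtain ⟨hp1, hp2⟩ := abs_lt.1 hp
  obtain ⟨hbt1, hbt2⟩ := abs_le.1 (abs_drift_le_one hD ω (l.getD t 0))
  obtain ⟨hb01, hb02⟩ := abs_le.1 (abs_drift_le_one hD ω (l.getD 0 0))
  obtain ⟨h3, h4⟩ : -(m : ℝ) < (((l.getD t 0) 0 : ℤ) : ℝ) ∧ (((l.getD t 0) 0 : ℤ) : ℝ) < m :=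
    ⟨by linarith [hq.1, hq.2, hr.1, hr.2], by linarith [hq.1, hq.2, hr.1, hr.2]⟩
  exact ⟨by exact_mod_cast h3, by exact_mod_cast h4⟩

end StubExitTimeBound

open StubPathReversal StubExitTimeBound in
/-- **Stub `stub_exitTimeBound`** of the crux `VerticalGamblersRuin` (line `registered`, rev 8;
exact registered signature, CONDITIONAL on the statements of `stub_forwardKolmogorov` and
`stub_pathReversal`, verbatim): **the annealed Lyons–Zheng exit-time bound** — for `m ≥ 1`, `T`
and the one-step averaging operator `𝒦_ω` of the SRW on the open lattice edges killed outside the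
open slab `(-m, m)`: `∫_{0↔∞} deg_ω(0) · (1 - (𝒦_ω^T 1)(0)) dP_{p_c} ≤ 480 · T / m²`.  Proof: see
the module docstring (pathwise bound `StubExitTimeBound.one_le_exceed_add`, link/mass/linearity/
support/monotonicity of `stub_pathFunctionalBasics`, reversal, Kolmogorov, `deg ≤ 6`). -/
theorem stub_exitTimeBound :
    (∀ D : BondConfig (Site 3) → Site 3 → ℝ,
      (∀ ω (z : Site 3), D ω z =
        (∑ y ∈ ((zdGraph 3).neighborFinset z).filter (fun y => s(z, y) ∈ ω),
            ((((y 0 : ℤ) : ℝ)) - ((z 0 : ℤ) : ℝ))) /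
          ((((zdGraph 3).neighborFinset z).filter (fun y => s(z, y) ∈ ω)).card : ℝ)) →
    ∀ E : BondConfig (Site 3) → ℕ → Site 3 → (List (Site 3) → ℝ) → ℝ,
      (∀ ω (x : Site 3) (G : List (Site 3) → ℝ), E ω 0 x G = G [x]) →
      (∀ ω (T : ℕ) (x : Site 3) (G : List (Site 3) → ℝ), E ω (T + 1) x G =
        (∑ y ∈ ((zdGraph 3).neighborFinset x).filter (fun y => s(x, y) ∈ ω),
            E ω T y (fun l => G (x :: l))) /
          ((((zdGraph 3).neighborFinset x).filter (fun y => s(x, y) ∈ ω)).card : ℝ)) →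
    ∀ (ω : BondConfig (Site 3)) (T : ℕ) (x : Site 3) (lam : ℝ), 0 < lam →
      1 ≤ (((zdGraph 3).neighborFinset x).filter (fun y => s(x, y) ∈ ω)).card →
      lam ^ 2 * E ω T x (fun l => if ∃ t < l.length,
          lam ≤ |(((l.getD t 0) 0 : ℤ) : ℝ) - (((l.getD 0 0) 0 : ℤ) : ℝ) -
            ∑ s ∈ Finset.range t, D ω (l.getD s 0)| then (1 : ℝ) else 0) ≤ 4 * T) →
    (∀ E : BondConfig (Site 3) → ℕ → Site 3 → (List (Site 3) → ℝ) → ℝ,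
      (∀ ω (x : Site 3) (G : List (Site 3) → ℝ), E ω 0 x G = G [x]) →
      (∀ ω (T : ℕ) (x : Site 3) (G : List (Site 3) → ℝ), E ω (T + 1) x G =
        (∑ y ∈ ((zdGraph 3).neighborFinset x).filter (fun y => s(x, y) ∈ ω),
            E ω T y (fun l => G (x :: l))) /
          ((((zdGraph 3).neighborFinset x).filter (fun y => s(x, y) ∈ ω)).card : ℝ)) →
    ∀ (T : ℕ) (G : BondConfig (Site 3) → List (Site 3) → ℝ),
      (∀ l, Measurable fun ω => G ω l) → (∀ ω l, 0 ≤ G ω l ∧ G ω l ≤ 1) →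
      ∫ ω in percolatesAt (0 : Site 3),
          ((((zdGraph 3).neighborFinset (0 : Site 3)).filter
              (fun y => s((0 : Site 3), y) ∈ ω)).card : ℝ) * E ω T 0 (G ω)
          ∂(bondPercolation (zdGraph 3) (criticalProbI 3)) =
        ∫ ω in percolatesAt (0 : Site 3),
          ((((zdGraph 3).neighborFinset (0 : Site 3)).filter
              (fun y => s((0 : Site 3), y) ∈ ω)).card : ℝ) *
            E ω T 0 (fun l => G (BondConfig.relabel (sym2Equiv (Site.shift (-(l.getLastD 0)))) ω)
              ((l.reverse).map (fun z => z - l.getLastD 0)))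
          ∂(bondPercolation (zdGraph 3) (criticalProbI 3))) →
    ∀ (m T : ℕ), 1 ≤ m →
      ∀ Kop : BondConfig (Site 3) → (Site 3 → ℝ) → Site 3 → ℝ,
        (∀ ω (g : Site 3 → ℝ) (x : Site 3), Kop ω g x =
          if -(m : ℤ) < x 0 ∧ x 0 < (m : ℤ) then
            (∑ y ∈ ((zdGraph 3).neighborFinset x).filter (fun y => s(x, y) ∈ ω), g y) /
              ((((zdGraph 3).neighborFinset x).filter (fun y => s(x, y) ∈ ω)).card : ℝ)
          else 0) →
        ∫ ω in percolatesAt (0 : Site 3),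
            ((((zdGraph 3).neighborFinset (0 : Site 3)).filter
                (fun y => s((0 : Site 3), y) ∈ ω)).card : ℝ) *
              (1 - ((Kop ω)^[T] (fun _ => (1 : ℝ))) 0)
            ∂(bondPercolation (zdGraph 3) (criticalProbI 3)) ≤ 480 * (T : ℝ) / ((m : ℝ) ^ 2) := by
  intro hA hB m T hm Kop hKop
  -- the drift and the path functional, pinned by their formulas (no definitions)
  obtain ⟨D, hD⟩ : ∃ D : BondConfig (Site 3) → Site 3 → ℝ, ∀ ω (z : Site 3), D ω z =
      (∑ y ∈ ((zdGraph 3).neighborFinset z).filter (fun y => s(z, y) ∈ ω),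
          ((((y 0 : ℤ) : ℝ)) - ((z 0 : ℤ) : ℝ))) /
        ((((zdGraph 3).neighborFinset z).filter (fun y => s(z, y) ∈ ω)).card : ℝ) :=
    ⟨_, fun _ _ => rfl⟩
  obtain ⟨E, hE0, hEs⟩ : ∃ E : BondConfig (Site 3) → ℕ → Site 3 → (List (Site 3) → ℝ) → ℝ,
      (∀ ω (x : Site 3) (G : List (Site 3) → ℝ), E ω 0 x G = G [x]) ∧
      (∀ ω (T : ℕ) (x : Site 3) (G : List (Site 3) → ℝ), E ω (T + 1) x G =
        (∑ y ∈ ((zdGraph 3).neighborFinset x).filter (fun y => s(x, y) ∈ ω),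
            E ω T y (fun l => G (x :: l))) /
          ((((zdGraph 3).neighborFinset x).filter (fun y => s(x, y) ∈ ω)).card : ℝ)) :=
    ⟨fun ω T => Nat.rec (motive := fun _ => Site 3 → (List (Site 3) → ℝ) → ℝ) (fun x G => G [x])
      (fun _ ih x G => (∑ y ∈ ((zdGraph 3).neighborFinset x).filter (fun y => s(x, y) ∈ ω),
        ih y (fun l => G (x :: l))) /
          ((((zdGraph 3).neighborFinset x).filter (fun y => s(x, y) ∈ ω)).card : ℝ)) T,
      fun _ _ _ => rfl, fun _ _ _ _ => rfl⟩
  have hA' := hA D hD E hE0 hEs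
  have hB' := hB E hE0 hEs
  have hPFB := stub_pathFunctionalBasics E hE0 hEs
  clear hA hB
  -- `T = 0`: the integrand vanishes
  rcases Nat.eq_zero_or_pos T with rfl | hT
  · simp
  set P := bondPercolation (zdGraph 3) (criticalProbI 3) with hPdef
  set deg : BondConfig (Site 3) → ℝ := fun ω =>
    ((((zdGraph 3).neighborFinset (0 : Site 3)).filter (fun y => s((0 : Site 3), y) ∈ ω)).card : ℝ)
    with hdegdef
  have hdeg0 : ∀ ω, 0 ≤ deg ω := fun ω => Nat.cast_nonneg _
  have hdeg6 : ∀ ω, deg ω ≤ 6 := fun ω => DeterministicTime.deg_le_six ω 0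
  have hdeg_meas : Measurable deg := StubStationarity.measurable_card_filter_zero
  have hintd : ∀ Y : BondConfig (Site 3) → ℝ, Measurable Y → (∀ ω, 0 ≤ Y ω ∧ Y ω ≤ 1) →
      Integrable (fun ω => deg ω * Y ω) P := by
    intro Y hY hb
    refine Integrable.of_bound (hdeg_meas.mul hY).aestronglyMeasurable 6
      (Eventually.of_forall fun ω => ?_)
    rw [Real.norm_eq_abs, abs_of_nonneg (mul_nonneg (hdeg0 ω) (hb ω).1)]
    calc deg ω * Y ω ≤ 6 * 1 := mul_le_mul (hdeg6 ω) (hb ω).2 (hb ω).1 (by norm_num)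
      _ = 6 := by norm_num
  -- the killed iterate is `[0, 1]`-valued and measurable; crude bound `∫ ≤ 6`
  have bK : ∀ ω, 0 ≤ 1 - ((Kop ω)^[T] fun _ => (1 : ℝ)) 0 ∧
      1 - ((Kop ω)^[T] fun _ => (1 : ℝ)) 0 ≤ 1 := fun ω => by
    have h := DeterministicTime.killed_iterate_mem_Icc (hKop ω) T
      (f := fun _ => (1 : ℝ)) (fun _ => ⟨zero_le_one, le_rfl⟩) 0
    exact ⟨sub_nonneg.2 h.2, sub_le_self _ h.1⟩
  have iK : Integrable (fun ω => deg ω * (1 - ((Kop ω)^[T] fun _ => (1 : ℝ)) 0)) P :=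
    hintd _ (measurable_const.sub (DeterministicTime.measurable_killed_iterate
      (F := fun _ _ => (1 : ℝ)) (fun _ => measurable_const) hKop T 0)) bK
  have hcrude : ∫ ω in percolatesAt (0 : Site 3),
      deg ω * (1 - ((Kop ω)^[T] fun _ => (1 : ℝ)) 0) ∂P ≤ 6 := by
    calc _ ≤ ∫ _ω in percolatesAt (0 : Site 3), (6 : ℝ) ∂P :=
          setIntegral_mono iK.integrableOn (integrable_const _).integrableOn fun ω => by
            calc deg ω * _ ≤ 6 * 1 := mul_le_mul (hdeg6 ω) (bK ω).2 (bK ω).1 (by norm_num)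
              _ = 6 := by norm_num
      _ ≤ 6 := by
          rw [setIntegral_const, smul_eq_mul]
          linarith [(measureReal_le_one : P.real (percolatesAt (0 : Site 3)) ≤ 1)]
  -- `m = 1`: the crude bound suffices
  rcases hm.eq_or_lt with rfl | hm2
  · have hT1 : (1 : ℝ) ≤ T := by exact_mod_cast hT
    calc _ ≤ (6 : ℝ) := hcrude
      _ ≤ 480 * (T : ℝ) / (((1 : ℕ) : ℝ) ^ 2) := by norm_num; linarith
  -- main case `m ≥ 2`, `T ≥ 1`: `λ = (2m - 2)/3`
  have hm2' : (2 : ℝ) ≤ m := by exact_mod_cast hm2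
  obtain ⟨lam, hlam_def⟩ : ∃ lam : ℝ, lam = (2 * (m : ℝ) - 2) / 3 := ⟨_, rfl⟩
  have hlam : 0 < lam := by rw [hlam_def]; exact div_pos (by linarith) (by norm_num)
  have hlm : 3 * lam + 2 ≤ 2 * (m : ℝ) := by rw [hlam_def]; linarith
  have hm3 : (m : ℝ) ≤ 3 * lam := by rw [hlam_def]; linarith
  -- the exceedance indicator `X`, its reversed-re-centred version `Xr`, the path indicators
  obtain ⟨X, hXdef⟩ : ∃ X : BondConfig (Site 3) → List (Site 3) → ℝ, X = fun ω l =>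
      if ∃ t < l.length, lam ≤ |(((l.getD t 0) 0 : ℤ) : ℝ) - (((l.getD 0 0) 0 : ℤ) : ℝ) -
        ∑ s ∈ Finset.range t, D ω (l.getD s 0)| then (1 : ℝ) else 0 := ⟨_, rfl⟩
  have hX := fun ω l => congrFun (congrFun hXdef ω) l
  obtain ⟨Xr, hXrdef⟩ : ∃ Xr : BondConfig (Site 3) → List (Site 3) → ℝ, Xr = fun ω l =>
      X (BondConfig.relabel (sym2Equiv (Site.shift (-(l.getLastD 0)))) ω)
        ((l.reverse).map (fun z => z - l.getLastD 0)) := ⟨_, rfl⟩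
  obtain ⟨I1, hI1⟩ : ∃ I1 : List (Site 3) → ℝ, I1 = fun l =>
      (if ∀ t < T, -(m : ℤ) < (l.getD t 0) 0 ∧ (l.getD t 0) 0 < (m : ℤ) then (1 : ℝ) else 0) * 1 :=
    ⟨_, rfl⟩
  obtain ⟨G2, hG2⟩ : ∃ G2 : List (Site 3) → ℝ, G2 = fun l =>
      if l.length = T + 1 ∧ l.getD 0 0 = 0 then 1 * 1 + (-1) * I1 l else 0 := ⟨_, rfl⟩
  have hX01 : ∀ ω l, 0 ≤ X ω l ∧ X ω l ≤ 1 := fun ω l => by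
    simp only [hXdef]; split_ifs <;> norm_num
  have hXr01 : ∀ ω l, 0 ≤ Xr ω l ∧ Xr ω l ≤ 1 := fun ω l => by rw [hXrdef]; exact hX01 _ _
  have hXm : ∀ l, Measurable fun ω => X ω l := measurable_exceed hD hX
  have hXrm : ∀ l, Measurable fun ω => Xr ω l := fun l => by
    simp only [hXrdef]
    exact (hXm _).comp (BondConfig.relabel (sym2Equiv (Site.shift (-(l.getLastD 0))))).measurable
  -- pointwise: `deg·(1 - 𝒦^T 1(0)) ≤ deg·E(X ω) + deg·E(Xr ω)` and `deg·E(X ω) ≤ 24 T/λ²`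
  have k1 : ∀ ω, deg ω * (1 - ((Kop ω)^[T] fun _ => (1 : ℝ)) 0) ≤
      deg ω * E ω T 0 (X ω) + deg ω * E ω T 0 (Xr ω) := by
    intro ω
    rcases eq_or_ne (deg ω) 0 with h0 | hne
    · rw [h0]; simp
    have hpos := Nat.pos_of_ne_zero (Nat.cast_ne_zero.1 hne)
    obtain ⟨hmono, hlin, -, -, hmass, hcongr, -, hkill⟩ := hPFB ω T 0
    rw [← mul_add, ← StubPathFunctionalBasics.add (hE0 ω) (hEs ω) T 0 (X ω) (Xr ω)]
    refine mul_le_mul_of_nonneg_left ?_ (hdeg0 ω)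
    have hK : ((Kop ω)^[T] fun _ => (1 : ℝ)) 0 = E ω T 0 I1 := by rw [hI1]; exact hkill m Kop hKop _
    have hstep : 1 - E ω T 0 I1 = E ω T 0 (fun l => 1 * 1 + (-1) * I1 l) := by
      rw [hlin, hmass hpos]; ring
    have hG2le : ∀ l, G2 l ≤ X ω l + Xr ω l := fun l => by
      have hx0 := add_nonneg (hX01 ω l).1 (hXr01 ω l).1
      simp only [hG2, hI1]
      split_ifs with hc hin
      · linarith
      · norm_num
        simp only [hXrdef]
        exact one_le_exceed_add hD hlm hX ω (l.getLastD 0) hc.1 hc.2 hin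
      · linarith
    calc 1 - ((Kop ω)^[T] fun _ => (1 : ℝ)) 0 = E ω T 0 (fun l => 1 * 1 + (-1) * I1 l) := by
          rw [hK, hstep]
      _ = E ω T 0 G2 := hcongr _ _ fun l hl hl0 => by simp only [hG2, hl, hl0, and_self, if_true]
      _ ≤ E ω T 0 (fun l => X ω l + Xr ω l) := hmono _ _ hG2le
  have k2 : ∀ ω, deg ω * E ω T 0 (X ω) ≤ 24 * T / lam ^ 2 := by
    intro ω
    rcases eq_or_ne (deg ω) 0 with h0 | hne
    · rw [h0, zero_mul]; positivity
    have hpos := Nat.pos_of_ne_zero (Nat.cast_ne_zero.1 hne)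
    have hE : E ω T 0 (X ω) ≤ 4 * T / lam ^ 2 := by
      rw [le_div_iff₀' (by positivity)]
      simpa only [hXdef] using hA' ω T 0 lam hlam hpos
    calc deg ω * E ω T 0 (X ω) ≤ 6 * (4 * T / lam ^ 2) :=
          mul_le_mul (hdeg6 ω) hE (E_mem_Icc hE0 hEs ω T 0 (hX01 ω)).1 (by norm_num)
      _ = 24 * T / lam ^ 2 := by ring
  -- integrate over `{0 ↔ ∞}` and use reversibility
  have iX : Integrable (fun ω => deg ω * E ω T 0 (X ω)) P :=
    hintd _ (measurable_E hE0 hEs T 0 hXm) fun ω => E_mem_Icc hE0 hEs ω T 0 (hX01 ω)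
  have iXr : Integrable (fun ω => deg ω * E ω T 0 (Xr ω)) P :=
    hintd _ (measurable_E hE0 hEs T 0 hXrm) fun ω => E_mem_Icc hE0 hEs ω T 0 (hXr01 ω)
  have hrev : ∫ ω in percolatesAt (0 : Site 3), deg ω * E ω T 0 (X ω) ∂P =
      ∫ ω in percolatesAt (0 : Site 3), deg ω * E ω T 0 (Xr ω) ∂P := by
    simp only [hXrdef]
    exact hB' T X hXm hX01
  have i2 : ∫ ω in percolatesAt (0 : Site 3), deg ω * E ω T 0 (X ω) ∂P ≤ 24 * T / lam ^ 2 := by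
    calc _ ≤ ∫ _ω in percolatesAt (0 : Site 3), 24 * (T : ℝ) / lam ^ 2 ∂P :=
          setIntegral_mono iX.integrableOn (integrable_const _).integrableOn k2
      _ ≤ 24 * T / lam ^ 2 := by
          rw [setIntegral_const, smul_eq_mul]
          exact mul_le_of_le_one_left (by positivity) measureReal_le_one
  have h9 : 48 * (T : ℝ) / lam ^ 2 ≤ 480 * (T : ℝ) / ((m : ℝ) ^ 2) := by
    rw [div_le_div_iff₀ (by positivity) (by positivity)]
    have hmm : ((m : ℝ)) ^ 2 ≤ (3 * lam) ^ 2 := pow_le_pow_left₀ (by positivity) hm3 2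
    nlinarith [mul_le_mul_of_nonneg_left hmm (by positivity : (0 : ℝ) ≤ 48 * (T : ℝ))]
  calc ∫ ω in percolatesAt (0 : Site 3), deg ω * (1 - ((Kop ω)^[T] fun _ => (1 : ℝ)) 0) ∂P
      ≤ ∫ ω in percolatesAt (0 : Site 3), (deg ω * E ω T 0 (X ω) + deg ω * E ω T 0 (Xr ω)) ∂P :=
        setIntegral_mono iK.integrableOn (iX.add iXr).integrableOn k1
    _ = 2 * ∫ ω in percolatesAt (0 : Site 3), deg ω * E ω T 0 (X ω) ∂P := by
        rw [integral_add iX.integrableOn iXr.integrableOn, ← hrev, two_mul]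
    _ ≤ 2 * (24 * T / lam ^ 2) := by linarith
    _ = 48 * (T : ℝ) / lam ^ 2 := by ring
    _ ≤ 480 * (T : ℝ) / ((m : ℝ) ^ 2) := h9

end Summit.CriticalPhenomena.PercolationContinuityZ3.Theorems.VerticalGamblersRuin
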